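import Summits.RiemannHypothesis.RiemannHypothesis.Theorems.OddSectorOddArchAnchorFold
import Literature.NumberTheory.LFunctions.WeilMarkovQuadratic
import HarnessLib

set_option linter.dupNamespace false

/-!
# Quantitative folded-kernel inequality (origin-layer line of `OddSector.OddOneSignedWindows`)

Stub `stub_foldArchGain` of the line `Sketch` of crux item stmt-RiemannHypothesis-17778 (RH-free,
lower Lebesgue integrals only). Normalisation of
`Literature/NumberTheory/LFunctions/WeilMarkovQuadratic.lean`: `ρ = weilArchDensity`
(non-increasing on `(0, ∞)`, `weilArchDensity_antitoneOn`), archimedean energy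
`∫₀^∞ ρ(t) ∫ |f(x+t) − f(x)|² dx dt`.

This is the quantitative twin of `OddArchAnchor.lintegral_arch_fold_le`
(Theorems/OddSectorOddArchAnchorFold.lean). For measurable ODD `g, h` with the RADIAL fold bounds
`|h(s) − h(x)| ≤ ||g(s)| − |g(x)||` and `|h(x)| ≤ |g(x)|` (`x, s > 0`),

  `∫₀^∞ ρ D(h) + 2 ∫∫_{x,s>0} δ(s,x) (ρ(|s−x|) − ρ(x+s)) dx ds ≤ ∫₀^∞ ρ D(g)`,

where `δ(s,x) = |g(s)||g(x)| − Re(g(s) conj g(x)) ≥ 0`. In the quadrant form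
(`OddArchAnchor.two_mul_lintegral_arch_eq_quadrant`) twice the two energies are the integrals over
`x, s > 0` of `2(K |f(s) − f(x)|² + P |f(s) + f(x)|²)`, `K = ρ(|s−x|) ≥ P = ρ(x+s)`, and with
`A = g(s)`, `B = g(x)`: `(|A| − |B|)² = |A − B|² − 2δ`, `(|A| + |B|)² = |A + B|² + 2δ`, so that
`K|h(s)−h(x)|² + P|h(s)+h(x)|² ≤ K(|A|−|B|)² + P(|A|+|B|)² = K|A−B|² + P|A+B|² − 2δ(K − P)`
(`OddArchAnchor.fold_core_real`); on the diagonal `s = x` the gain vanishes (`δ(x,x) = 0`).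
Integrating (no measurability is needed in this direction, `le_lintegral_add`) gives the claim.
-/

noncomputable section

open Complex Filter Set MeasureTheory
open scoped Real Topology ComplexConjugate ENNReal

namespace Summit.RiemannHypothesis.RiemannHypothesis.Theorems.OddSector

open Literature.NumberTheory.LFunctions
open Summit.RiemannHypothesis.RiemannHypothesis.Theorems.OddArchAnchor (fold_core_real
  norm_sub_sq_add_norm_add_sq two_mul_lintegral_arch_eq_quadrant)

-- adapted from Theorems/OddSectorOddArchAnchorFold.lean

/-! ## The kernel -/

/-- `ρ(|t|) ≥ 0` (with the junk value `ρ(0) = e⁰/(2 sinh 0) = 0`). -/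
private theorem weilArchDensity_abs_nonneg (t : ℝ) : 0 ≤ weilArchDensity |t| :=
  div_nonneg (Real.exp_pos _).le
    (mul_nonneg zero_le_two (Real.sinh_nonneg_iff.2 (abs_nonneg t)))

/-- The two half-line kernels of the quadrant form add up to the even kernel `ρ(|t|)`:
`𝟙_{(0,∞)}ρ(t) + 𝟙_{(0,∞)}ρ(−t) = ρ(|t|)` (at `t = 0` both sides vanish, `sinh 0 = 0`). -/
private theorem indicator_add_indicator_neg_eq_abs (t : ℝ) :
    (Ioi (0 : ℝ)).indicator weilArchDensity t + (Ioi (0 : ℝ)).indicator weilArchDensity (-t) =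
      weilArchDensity |t| := by
  rcases lt_trichotomy t 0 with ht | rfl | ht
  · have h1 : t ∉ Ioi (0 : ℝ) := fun h' ↦ lt_asymm ht (mem_Ioi.1 h')
    have h2 : -t ∈ Ioi (0 : ℝ) := mem_Ioi.2 (neg_pos.2 ht)
    rw [indicator_of_notMem h1, indicator_of_mem h2, abs_of_neg ht, zero_add]
  · have h1 : (0 : ℝ) ∉ Ioi (0 : ℝ) := fun h' ↦ lt_irrefl _ (mem_Ioi.1 h')
    rw [neg_zero, abs_zero, indicator_of_notMem h1, add_zero]
    simp [weilArchDensity]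
  · have h1 : t ∈ Ioi (0 : ℝ) := mem_Ioi.2 ht
    have h2 : -t ∉ Ioi (0 : ℝ) := fun h' ↦ lt_asymm ht (neg_pos.1 (mem_Ioi.1 h'))
    rw [indicator_of_mem h1, indicator_of_notMem h2, abs_of_pos ht, add_zero]

/-- **Normalisation of the quadrant integrand** of `two_mul_lintegral_arch_eq_quadrant` for an odd
`f` at `x, s > 0`: it equals `2 (ρ(|s−x|) |f(s) − f(x)|² + ρ(x+s) |f(s) + f(x)|²)`. -/
private theorem quadrant_integrand_eq {f : ℝ → ℂ} (hfo : ∀ x, f (-x) = -f x) {x s : ℝ}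
    (hx : 0 < x) (hs : 0 < s) :
    (ENNReal.ofReal ((Ioi (0 : ℝ)).indicator weilArchDensity (s - x)) +
            ENNReal.ofReal ((Ioi (0 : ℝ)).indicator weilArchDensity (x - s))) *
            ENNReal.ofReal (‖f s - f x‖ ^ 2) +
          (ENNReal.ofReal ((Ioi (0 : ℝ)).indicator weilArchDensity (-s - x)) +
            ENNReal.ofReal ((Ioi (0 : ℝ)).indicator weilArchDensity (x - -s))) *
            ENNReal.ofReal (‖f (-s) - f x‖ ^ 2) +
          ((ENNReal.ofReal ((Ioi (0 : ℝ)).indicator weilArchDensity (s - -x)) +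
            ENNReal.ofReal ((Ioi (0 : ℝ)).indicator weilArchDensity (-x - s))) *
            ENNReal.ofReal (‖f s - f (-x)‖ ^ 2) +
          (ENNReal.ofReal ((Ioi (0 : ℝ)).indicator weilArchDensity (-s - -x)) +
            ENNReal.ofReal ((Ioi (0 : ℝ)).indicator weilArchDensity (-x - -s))) *
            ENNReal.ofReal (‖f (-s) - f (-x)‖ ^ 2)) =
      2 * (ENNReal.ofReal (weilArchDensity |s - x|) * ENNReal.ofReal (‖f s - f x‖ ^ 2) +
        ENNReal.ofReal (weilArchDensity (x + s)) * ENNReal.ofReal (‖f s + f x‖ ^ 2)) := by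
  set kr : ℝ → ℝ := (Ioi (0 : ℝ)).indicator weilArchDensity with hkr
  have hk_pos : ∀ t, 0 < t → kr t = weilArchDensity t := fun t ht ↦ by
    rw [hkr, indicator_of_mem (mem_Ioi.2 ht)]
  have hk_npos : ∀ t, t ≤ 0 → kr t = 0 := fun t ht ↦ by
    rw [hkr, indicator_of_notMem (fun h' ↦ not_lt.2 ht (mem_Ioi.1 h'))]
  have hkr0 : ∀ t, 0 ≤ kr t := fun t ↦ by
    rcases le_or_gt t 0 with ht | ht
    · rw [hk_npos t ht]
    · rw [hk_pos t ht]; exact (weilArchDensity_pos ht).le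
  have hK : kr (s - x) + kr (x - s) = weilArchDensity |s - x| := by
    rw [hkr, ← neg_sub s x]
    exact indicator_add_indicator_neg_eq_abs (s - x)
  -- normalise the kernel arguments
  have e2 : x - -s = x + s := by ring
  have e3 : s - -x = x + s := by ring
  have e5 : -s - -x = x - s := by ring
  have e6 : -x - -s = s - x := by ring
  rw [hk_npos _ (by linarith : -s - x ≤ 0), e2, e3, hk_npos _ (by linarith : -x - s ≤ 0), e5, e6,
    hk_pos _ (by linarith : 0 < x + s)]
  simp only [ENNReal.ofReal_zero, zero_add, add_zero]
  -- oddness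
  have o1 : ‖f (-s) - f x‖ = ‖f s + f x‖ := by
    rw [hfo, show -f s - f x = -(f s + f x) by ring, norm_neg]
  have o2 : ‖f s - f (-x)‖ = ‖f s + f x‖ := by rw [hfo, sub_neg_eq_add]
  have o3 : ‖f (-s) - f (-x)‖ = ‖f s - f x‖ := by
    rw [hfo, hfo, show -f s - -f x = -(f s - f x) by ring, norm_neg]
  rw [o1, o2, o3, add_comm (ENNReal.ofReal (kr (x - s))) (ENNReal.ofReal (kr (s - x))),
    ← ENNReal.ofReal_add (hkr0 _) (hkr0 _), hK]
  ring

/-! ## The pointwise inequality with gain -/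

/-- `Re(A conj B) ≤ |A| |B|`, i.e. `δ(A, B) = |A||B| − Re(A conj B) ≥ 0`. -/
private theorem delta_nonneg (A B : ℂ) : 0 ≤ ‖A‖ * ‖B‖ - (A * conj B).re :=
  sub_nonneg.2 ((Complex.re_le_norm _).trans_eq (by rw [norm_mul, Complex.norm_conj]))

/-- `δ(A, A) = |A|² − Re(A conj A) = 0`. -/
private theorem delta_self (A : ℂ) : ‖A‖ * ‖A‖ - (A * conj A).re = 0 := by
  rw [Complex.mul_conj, Complex.ofReal_re, Complex.normSq_eq_norm_sq, sq, sub_self]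

/-- **The real core with gain.** For `K ≥ P ≥ 0` (or coinciding points), values with
`|h(s) − h(x)| ≤ ||g(s)| − |g(x)||`, `|h(x)| ≤ |g(x)|`, `|h(s)| ≤ |g(s)|`:
`K|h(s)−h(x)|² + P|h(s)+h(x)|² + 2δ(K − P) ≤ K|g(s)−g(x)|² + P|g(s)+g(x)|²`,
`δ = |g(s)||g(x)| − Re(g(s) conj g(x))`: indeed `fold_core_real` bounds the left quadratic part by
`K(|g(s)|−|g(x)|)² + P(|g(s)|+|g(x)|)² = K|g(s)−g(x)|² + P|g(s)+g(x)|² − 2δ(K − P)`. -/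
private theorem gain_core_real {hx hs gx gs : ℂ} {K P : ℝ} (hP : 0 ≤ P)
    (hK : P ≤ K ∨ (hs = hx ∧ gs = gx)) (hd : ‖hs - hx‖ ≤ |‖gs‖ - ‖gx‖|) (hnx : ‖hx‖ ≤ ‖gx‖)
    (hns : ‖hs‖ ≤ ‖gs‖) :
    K * ‖hs - hx‖ ^ 2 + P * ‖hs + hx‖ ^ 2 +
        2 * ((‖gs‖ * ‖gx‖ - (gs * conj gx).re) * (K - P)) ≤
      K * ‖gs - gx‖ ^ 2 + P * ‖gs + gx‖ ^ 2 := by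
  have ha : ‖hs - hx‖ ^ 2 ≤ (‖gs‖ - ‖gx‖) ^ 2 := by
    rw [← sq_abs (‖gs‖ - ‖gx‖)]
    exact pow_le_pow_left₀ (norm_nonneg _) hd 2
  have hab : ‖hs - hx‖ ^ 2 + ‖hs + hx‖ ^ 2 ≤ (‖gs‖ - ‖gx‖) ^ 2 + (‖gs‖ + ‖gx‖) ^ 2 := by
    have e : (‖gs‖ - ‖gx‖) ^ 2 + (‖gs‖ + ‖gx‖) ^ 2 = 2 * ‖gs‖ ^ 2 + 2 * ‖gx‖ ^ 2 := by ring
    rw [norm_sub_sq_add_norm_add_sq, e]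
    nlinarith [pow_le_pow_left₀ (norm_nonneg _) hnx 2, pow_le_pow_left₀ (norm_nonneg _) hns 2]
  have hK' : P ≤ K ∨ (‖hs - hx‖ ^ 2 = 0 ∧ (‖gs‖ - ‖gx‖) ^ 2 = 0) := by
    rcases hK with h | ⟨h1, h2⟩
    · exact Or.inl h
    · exact Or.inr ⟨by simp [h1], by simp [h2]⟩
  have hcore := fold_core_real (bh := ‖hs + hx‖ ^ 2) (bg := (‖gs‖ + ‖gx‖) ^ 2) hK' hP ha hab
  have hsub : ‖gs - gx‖ ^ 2 = ‖gs‖ ^ 2 + ‖gx‖ ^ 2 - 2 * (gs * conj gx).re := by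
    rw [← Complex.normSq_eq_norm_sq, ← Complex.normSq_eq_norm_sq, ← Complex.normSq_eq_norm_sq,
      Complex.normSq_sub]
  have hadd : ‖gs + gx‖ ^ 2 = ‖gs‖ ^ 2 + ‖gx‖ ^ 2 + 2 * (gs * conj gx).re := by
    rw [← Complex.normSq_eq_norm_sq, ← Complex.normSq_eq_norm_sq, ← Complex.normSq_eq_norm_sq,
      Complex.normSq_add]
  calc K * ‖hs - hx‖ ^ 2 + P * ‖hs + hx‖ ^ 2 +
        2 * ((‖gs‖ * ‖gx‖ - (gs * conj gx).re) * (K - P))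
      ≤ K * (‖gs‖ - ‖gx‖) ^ 2 + P * (‖gs‖ + ‖gx‖) ^ 2 +
          2 * ((‖gs‖ * ‖gx‖ - (gs * conj gx).re) * (K - P)) := add_le_add hcore le_rfl
    _ = K * ‖gs - gx‖ ^ 2 + P * ‖gs + gx‖ ^ 2 := by
        rw [hsub, hadd]
        ring

/-- **The pointwise folded-kernel inequality with gain** (extended-real form, in the shape of the
normalised quadrant integrand `quadrant_integrand_eq`): for `K ≥ P ≥ 0` (or coinciding points)
`2(K a_h + P b_h) + 4 δ (K − P) ≤ 2(K a_g + P b_g)`. -/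
private theorem gain_pointwise {hx hs gx gs : ℂ} {K P : ℝ} (hK0 : 0 ≤ K) (hP : 0 ≤ P)
    (hK : P ≤ K ∨ (hs = hx ∧ gs = gx)) (hd : ‖hs - hx‖ ≤ |‖gs‖ - ‖gx‖|) (hnx : ‖hx‖ ≤ ‖gx‖)
    (hns : ‖hs‖ ≤ ‖gs‖) :
    2 * (ENNReal.ofReal K * ENNReal.ofReal (‖hs - hx‖ ^ 2) +
          ENNReal.ofReal P * ENNReal.ofReal (‖hs + hx‖ ^ 2)) +
        2 * 2 * ENNReal.ofReal ((‖gs‖ * ‖gx‖ - (gs * conj gx).re) * (K - P)) ≤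
      2 * (ENNReal.ofReal K * ENNReal.ofReal (‖gs - gx‖ ^ 2) +
          ENNReal.ofReal P * ENNReal.ofReal (‖gs + gx‖ ^ 2)) := by
  have hY : 0 ≤ (‖gs‖ * ‖gx‖ - (gs * conj gx).re) * (K - P) := by
    rcases hK with h | ⟨-, h2⟩
    · exact mul_nonneg (delta_nonneg gs gx) (sub_nonneg.2 h)
    · rw [h2, delta_self, zero_mul]
  have hXh : 0 ≤ K * ‖hs - hx‖ ^ 2 + P * ‖hs + hx‖ ^ 2 :=
    add_nonneg (mul_nonneg hK0 (sq_nonneg _)) (mul_nonneg hP (sq_nonneg _))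
  have hcore := gain_core_real hP hK hd hnx hns
  calc 2 * (ENNReal.ofReal K * ENNReal.ofReal (‖hs - hx‖ ^ 2) +
          ENNReal.ofReal P * ENNReal.ofReal (‖hs + hx‖ ^ 2)) +
        2 * 2 * ENNReal.ofReal ((‖gs‖ * ‖gx‖ - (gs * conj gx).re) * (K - P))
      = 2 * ENNReal.ofReal (K * ‖hs - hx‖ ^ 2 + P * ‖hs + hx‖ ^ 2 +
          2 * ((‖gs‖ * ‖gx‖ - (gs * conj gx).re) * (K - P))) := by
        rw [ENNReal.ofReal_add hXh (mul_nonneg zero_le_two hY),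
          ENNReal.ofReal_add (mul_nonneg hK0 (sq_nonneg _)) (mul_nonneg hP (sq_nonneg _)),
          ENNReal.ofReal_mul hK0, ENNReal.ofReal_mul hP, ENNReal.ofReal_mul zero_le_two,
          ENNReal.ofReal_ofNat]
        ring
    _ ≤ 2 * ENNReal.ofReal (K * ‖gs - gx‖ ^ 2 + P * ‖gs + gx‖ ^ 2) :=
        (ENNReal.mul_le_mul_iff_right two_ne_zero ENNReal.ofNat_ne_top).2
          (ENNReal.ofReal_le_ofReal hcore)
    _ = 2 * (ENNReal.ofReal K * ENNReal.ofReal (‖gs - gx‖ ^ 2) +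
          ENNReal.ofReal P * ENNReal.ofReal (‖gs + gx‖ ^ 2)) := by
        rw [ENNReal.ofReal_add (mul_nonneg hK0 (sq_nonneg _)) (mul_nonneg hP (sq_nonneg _)),
          ENNReal.ofReal_mul hK0, ENNReal.ofReal_mul hP]

/-! ## Integration over the quadrant -/

/-- Integrating a pointwise inequality `F + c G ≤ H` over the open quadrant `x, s > 0`
(no measurability is needed in this direction: `le_lintegral_add`). -/
private theorem quadrant_add_mul_le {F G H : ℝ → ℝ → ℝ≥0∞} {c : ℝ≥0∞} (hc : c ≠ ∞)
    (hpt : ∀ x s, 0 < x → 0 < s → F x s + c * G x s ≤ H x s) :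
    (∫⁻ x in Ioi (0 : ℝ), ∫⁻ s in Ioi (0 : ℝ), F x s) +
        c * ∫⁻ x in Ioi (0 : ℝ), ∫⁻ s in Ioi (0 : ℝ), G x s ≤
      ∫⁻ x in Ioi (0 : ℝ), ∫⁻ s in Ioi (0 : ℝ), H x s := by
  have h1 : c * ∫⁻ x in Ioi (0 : ℝ), ∫⁻ s in Ioi (0 : ℝ), G x s =
      ∫⁻ x in Ioi (0 : ℝ), ∫⁻ s in Ioi (0 : ℝ), c * G x s := by
    rw [← lintegral_const_mul' c _ hc]
    exact lintegral_congr fun x ↦ (lintegral_const_mul' c _ hc).symm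
  rw [h1]
  calc (∫⁻ x in Ioi (0 : ℝ), ∫⁻ s in Ioi (0 : ℝ), F x s) +
        ∫⁻ x in Ioi (0 : ℝ), ∫⁻ s in Ioi (0 : ℝ), c * G x s
      ≤ ∫⁻ x in Ioi (0 : ℝ), ((∫⁻ s in Ioi (0 : ℝ), F x s) + ∫⁻ s in Ioi (0 : ℝ), c * G x s) :=
        le_lintegral_add _ _
    _ ≤ ∫⁻ x in Ioi (0 : ℝ), ∫⁻ s in Ioi (0 : ℝ), (F x s + c * G x s) :=
        lintegral_mono fun x ↦ le_lintegral_add _ _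
    _ ≤ ∫⁻ x in Ioi (0 : ℝ), ∫⁻ s in Ioi (0 : ℝ), H x s :=
        setLIntegral_mono' measurableSet_Ioi fun x hx ↦
          setLIntegral_mono' measurableSet_Ioi fun s hs ↦ hpt x s hx hs

/-! ## The quantitative folded-kernel inequality -/

/-- **Quantitative folded-kernel inequality (RH-free).** For measurable odd `g, h` with the radial
fold bounds on the half-line, the archimedean energy of `h` plus the GAIN
`2 ∫∫_{x,s>0} (|g(s)||g(x)| − Re(g(s) conj g(x))) (ρ(|s−x|) − ρ(x+s))` is at most the
archimedean energy of `g` (lower Lebesgue integrals; `ρ = weilArchDensity`, antitone, so the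
folded kernel `ρ(|s−x|) − ρ(x+s)` is `≥ 0` off the diagonal; cf.
`OddArchAnchor.lintegral_arch_fold_le`). -/
theorem stub_foldArchGain :
    ∀ (g h : ℝ → ℂ), Measurable g → Measurable h → (∀ x, g (-x) = -g x) → (∀ x, h (-x) = -h x) →
      (∀ x s, 0 < x → 0 < s → ‖h s - h x‖ ≤ |‖g s‖ - ‖g x‖|) → (∀ x, 0 < x → ‖h x‖ ≤ ‖g x‖) →
      (∫⁻ t in Ioi (0 : ℝ), ENNReal.ofReal (weilArchDensity t) *
          ∫⁻ x, ENNReal.ofReal (‖h (x + t) - h x‖ ^ 2)) +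
        2 * ∫⁻ x in Ioi (0 : ℝ), ∫⁻ s in Ioi (0 : ℝ),
          ENNReal.ofReal ((‖g s‖ * ‖g x‖ - (g s * conj (g x)).re) *
            (weilArchDensity |s - x| - weilArchDensity (x + s))) ≤
      ∫⁻ t in Ioi (0 : ℝ), ENNReal.ofReal (weilArchDensity t) *
          ∫⁻ x, ENNReal.ofReal (‖g (x + t) - g x‖ ^ 2) := by
  intro g h hgm hhm hgo hho hd hn
  rw [← ENNReal.mul_le_mul_iff_right (a := 2) two_ne_zero ENNReal.ofNat_ne_top, mul_add,
    two_mul_lintegral_arch_eq_quadrant hhm, two_mul_lintegral_arch_eq_quadrant hgm, ← mul_assoc]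
  refine quadrant_add_mul_le (ENNReal.mul_ne_top ENNReal.ofNat_ne_top ENNReal.ofNat_ne_top)
    fun x s hx hs ↦ ?_
  rw [quadrant_integrand_eq hho hx hs, quadrant_integrand_eq hgo hx hs]
  -- the folded kernel is non-negative off the diagonal (`ρ` is non-increasing)
  have hK : weilArchDensity (x + s) ≤ weilArchDensity |s - x| ∨ (h s = h x ∧ g s = g x) := by
    rcases eq_or_ne s x with heq | hne
    · exact Or.inr ⟨by rw [heq], by rw [heq]⟩
    · exact Or.inl (weilArchDensity_antitoneOn (mem_Ioi.2 (abs_pos.2 (sub_ne_zero.2 hne)))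
        (mem_Ioi.2 (by linarith)) (abs_sub_le_iff.2 ⟨by linarith, by linarith⟩))
  exact gain_pointwise (weilArchDensity_abs_nonneg _) (weilArchDensity_pos (by linarith)).le hK
    (hd x s hx hs) (hn x hx) (hn s hs)

end Summit.RiemannHypothesis.RiemannHypothesis.Theorems.OddSector

end
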